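import Literature.NumberTheory.EllipticCurves.BoxerDiao2010.TamagawaTwistLocalProofs
import Literature.NumberTheory.DiophantineGeometry.TateAlgorithmRootCount
import Mathlib.NumberTheory.Padics.RingHoms
import HarnessLib

/-!
# Boxer–Diao 2010, proof of Prop. 4.1 at the ODD primes: the local Tamagawa numbers of the
# integer twist model `y² = x³ + 4d a₂ x² + 16d² a₄ x + 16d³(4a₆ + 1)` over `ℤ_p` (proofs)

`Proofs` file (theorems only: no definition, no named fact, no instance), topic
`Literature/NumberTheory/EllipticCurves`, namespace `Literature.NumberTheory.EllipticCurves.BoxerDiao2010`.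

Let `M = (0, a₂, 1, a₄, a₆)` be an integer Weierstrass equation (the minimal model
`y² + y = x³ + a₂x² + a₄x + a₆` of a "good" curve of G. Boxer, P. Diao, *2-Selmer groups of
quadratic twists of elliptic curves*, Proc. AMS 138 (2010), p. 1971 Remark) and `d ∈ ℤ`. The
integer equation `J = (0, 4d a₂, 0, 16d² a₄, 16d³(4a₆ + 1))` is the tree's quadratic twist
`M^{(d)} = (0, d b₂/4, 0, d² b₄/2, d³ b₆/4)` rescaled by `u = ½` (`QuadraticTwist.lean`; the
isomorphism is recorded in the sibling `TamagawaTwistHolds`); it has `c₄(J) = 16 d² c₄(M)`,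
`Δ(J) = 2¹² d⁶ Δ(M)`, and at a prime `p ∣ d`, `d = p d₁`, it is in the Step-6 shape of Tate's
algorithm with cubic `P(T) = T³ + 4d₁a₂T² + 16d₁²a₄T + 16d₁³(4a₆ + 1)`, whose roots mod `p` are
`4d₁` times those of `h(x) = 4x³ + 4a₂x² + 4a₄x + 4a₆ + 1` (the `2`-division polynomial of
`M mod p`: "the number of 2-torsion of `E` mod `p`"). This file computes, for an odd prime `p`,
the local Tamagawa number `c_p = [J(ℚ_p) : J₀(ℚ_p)]` exactly as in the printed proof (pp. 1976–1977):

* `p ∤ dΔ`: `c_p = 1` (good reduction);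
* `p ∣ Δ`, `p ∤ d c₄(M)`, `v_p(Δ)` odd: `c_p` odd (multiplicative, "either `1` or `v_p(Δ_E)`");
* `p ∥ d`, `p ∤ Δ`: `c_p = 1` if `h` has no root mod `p`, and `2 ∣ c_p` if it has one (type
  `I₀*`, "`c_p` is equal to `1` plus the number of roots … which is the same as the number of
  2-torsion of `E` mod `p`");
* `p ∥ d`, `p ∣ Δ`, `p ∤ c₄(M)`: `2 ∣ c_p` (type `Iₙ*`, "`c_p = 2` or `4`").

Everything is proved from `TamagawaTwistLocalProofs` (explicit minimal models over a Henselian DVR)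
specialised to `R = ℤ_p`; no Kodaira symbol is computed.

## References

* G. Boxer, P. Diao, *2-Selmer groups of quadratic twists of elliptic curves*, Proc. Amer. Math.
  Soc. 138 (2010) 1969–1978, Prop. 4.1 and its proof (pp. 1976–1977). [BoxerDiao2010]
* J. H. Silverman, *Advanced Topics in the Arithmetic of Elliptic Curves* (1994), IV.9.4.
  [SilvermanATAEC1994]
-/

noncomputable section

open scoped Classical

open IsLocalRing

namespace Literature.NumberTheory.EllipticCurves

namespace BoxerDiao2010

/-! ### `ℤ_p` helpers -/

/-- An integer prime to `p` is a unit of `ℤ_p`. [folklore] -/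
private theorem isUnit_intCast_padicInt_of_not_dvd {p : ℕ} [Fact p.Prime] {z : ℤ} (h : ¬ (p : ℤ) ∣ z) :
    IsUnit (z : ℤ_[p]) := by
  rw [PadicInt.isUnit_iff]
  exact le_antisymm (PadicInt.norm_le_one _)
    (not_lt.mp fun hlt => h ((PadicInt.norm_int_lt_one_iff_dvd z).mp hlt))

/-- An integer divisible by `p` lies in the maximal ideal of `ℤ_p`. [folklore] -/
private theorem intCast_mem_maximalIdeal_padicInt_of_dvd {p : ℕ} [Fact p.Prime] {z : ℤ} (h : (p : ℤ) ∣ z) :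
    (z : ℤ_[p]) ∈ maximalIdeal ℤ_[p] := by
  rw [PadicInt.maximalIdeal_eq_span_p, Ideal.mem_span_singleton]
  obtain ⟨c, rfl⟩ := h
  exact ⟨(c : ℤ_[p]), by push_cast; ring⟩

/-- `ℤ_p` is Henselian (it is `p`-adically complete). [folklore] -/
private theorem henselianLocalRing_padicInt' (p : ℕ) [Fact p.Prime] : HenselianLocalRing ℤ_[p] :=
  { is_henselian := fun f hf a₀ h₁ h₂ =>
      HenselianRing.is_henselian (I := IsLocalRing.maximalIdeal ℤ_[p]) f hf a₀ h₁ (h₂.map _) }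

/-- The residue field of `ℤ_p` is finite. [folklore] -/
private theorem finite_residueField_padicInt (p : ℕ) [Fact p.Prime] : Finite (ResidueField ℤ_[p]) :=
  Finite.of_equiv (ZMod p) (PadicInt.residueField (p := p)).symm.toEquiv

/-- `p`-adic decomposition of a non-zero integer: `z = p^{v_p(z)} · m` with `p ∤ m`. [folklore] -/
private theorem exists_eq_pow_padicValInt_mul_not_dvd {p : ℕ} [hp : Fact p.Prime] {z : ℤ} (hz : z ≠ 0) :
    ∃ m : ℤ, z = (p : ℤ) ^ padicValInt p z * m ∧ ¬ (p : ℤ) ∣ m := by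
  set n := padicValInt p z with hn
  obtain ⟨m, hm⟩ : (p : ℤ) ^ n ∣ z := hn ▸ padicValInt_dvd (p := p) z
  refine ⟨m, hm, fun ⟨c, hc⟩ => ?_⟩
  have h : (p : ℤ) ^ (n + 1) ∣ z := ⟨c, by rw [hm, hc]; ring⟩
  rcases (padicValInt_dvd_iff _ _).mp h with h0 | hle
  · exact hz h0
  · rw [← hn] at hle; omega

/-! ### The integer model `J = (0, 4d a₂, 0, 16d² a₄, 16d³(4a₆ + 1))`: invariants -/

section Invariants

variable {S : Type*} [CommRing S]

/-- `c₄(J) = 16 d² c₄(M)` for `M = (0, a₂, 1, a₄, a₆)` and `J = (0, 4da₂, 0, 16d²a₄, 16d³(4a₆+1))`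
(scaling by `u = ½` and twisting multiply `c₄` by `2⁴` and `d²`; Silverman *AEC* III.1 Table 3.1).
[cite: SilvermanAEC2009, III.1 Table 3.1] -/
theorem c₄_twistIntModel (a₂ a₄ a₆ d : S) :
    (⟨0, 4 * d * a₂, 0, 16 * d ^ 2 * a₄, 16 * d ^ 3 * (4 * a₆ + 1)⟩ : WeierstrassCurve S).c₄ =
      16 * d ^ 2 * (⟨0, a₂, 1, a₄, a₆⟩ : WeierstrassCurve S).c₄ := by
  simp only [WeierstrassCurve.c₄, WeierstrassCurve.b₂, WeierstrassCurve.b₄]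
  ring

/-- `Δ(J) = 2¹² d⁶ Δ(M)` for `M = (0, a₂, 1, a₄, a₆)` and `J = (0, 4da₂, 0, 16d²a₄, 16d³(4a₆+1))`
(Silverman *AEC* III.1 Table 3.1 and X.5: `Δ(E^{(d)}) = d⁶Δ(E)`). [cite: SilvermanAEC2009, III.1 Table 3.1] -/
theorem Δ_twistIntModel (a₂ a₄ a₆ d : S) :
    (⟨0, 4 * d * a₂, 0, 16 * d ^ 2 * a₄, 16 * d ^ 3 * (4 * a₆ + 1)⟩ : WeierstrassCurve S).Δ =
      2 ^ 12 * d ^ 6 * (⟨0, a₂, 1, a₄, a₆⟩ : WeierstrassCurve S).Δ := by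
  simp only [WeierstrassCurve.Δ, WeierstrassCurve.b₂, WeierstrassCurve.b₄, WeierstrassCurve.b₆,
    WeierstrassCurve.b₈]
  ring

/-- `c₄(M) = 16(a₂² − 3a₄)` for `M = (0, a₂, 1, a₄, a₆)`. [cite: SilvermanAEC2009, III.1] -/
theorem c₄_model (a₂ a₄ a₆ : S) :
    (⟨0, a₂, 1, a₄, a₆⟩ : WeierstrassCurve S).c₄ = 16 * (a₂ ^ 2 - 3 * a₄) := by
  simp only [WeierstrassCurve.c₄, WeierstrassCurve.b₂, WeierstrassCurve.b₄]
  ring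

/-- `Δ(M) = 16 a₂²a₄² − 64 a₄³ − 16 a₂³(4a₆+1) − 27(4a₆+1)² + 72 a₂a₄(4a₆+1)` for
`M = (0, a₂, 1, a₄, a₆)`: sixteen times the discriminant of the `2`-division cubic
`x³ + a₂x² + a₄x + a₆ + ¼`. [cite: SilvermanAEC2009, III.1] -/
theorem Δ_model (a₂ a₄ a₆ : S) :
    (⟨0, a₂, 1, a₄, a₆⟩ : WeierstrassCurve S).Δ =
      16 * a₂ ^ 2 * a₄ ^ 2 - 64 * a₄ ^ 3 - 16 * a₂ ^ 3 * (4 * a₆ + 1) - 27 * (4 * a₆ + 1) ^ 2 +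
        72 * a₂ * a₄ * (4 * a₆ + 1) := by
  simp only [WeierstrassCurve.Δ, WeierstrassCurve.b₂, WeierstrassCurve.b₄, WeierstrassCurve.b₆,
    WeierstrassCurve.b₈]
  ring

/-- In a field of characteristic `≠ 2`: a double root of `h(x) = 4x³ + 4a₂x² + 4a₄x + 4a₆ + 1`
kills `Δ(M)` (the discriminant of the monic cubic `h/4` is `Δ(M)/16`, and vanishes at a double
root, `LocalIndex.cubicDiscr_eq_zero_of_double_root`). [folklore] -/
private theorem Δ_model_eq_zero_of_double_root {F : Type*} [Field F] (h2 : (2 : F) ≠ 0) {a₂ a₄ a₆ x : F}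
    (hx : 4 * x ^ 3 + 4 * a₂ * x ^ 2 + 4 * a₄ * x + (4 * a₆ + 1) = 0)
    (hx' : 12 * x ^ 2 + 8 * a₂ * x + 4 * a₄ = 0) :
    (⟨0, a₂, 1, a₄, a₆⟩ : WeierstrassCurve F).Δ = 0 := by
  have h4 : (4 : F) ≠ 0 := by
    rw [show (4 : F) = 2 * 2 by norm_num]; exact mul_ne_zero h2 h2
  have hg : x ^ 3 + a₂ * x ^ 2 + a₄ * x + (4 * a₆ + 1) / 4 = 0 := by
    field_simp
    linear_combination hx
  have hg' : 3 * x ^ 2 + 2 * a₂ * x + a₄ = 0 := by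
    have : (3 * x ^ 2 + 2 * a₂ * x + a₄) * 4 = 0 := by linear_combination hx'
    exact (mul_eq_zero.mp this).resolve_right h4
  have hdisc := LocalIndex.cubicDiscr_eq_zero_of_double_root hg hg'
  rw [Δ_model]
  have e : (16 * a₂ ^ 2 * a₄ ^ 2 - 64 * a₄ ^ 3 - 16 * a₂ ^ 3 * (4 * a₆ + 1) -
      27 * (4 * a₆ + 1) ^ 2 + 72 * a₂ * a₄ * (4 * a₆ + 1) : F) =
      16 * (a₂ ^ 2 * a₄ ^ 2 - 4 * a₄ ^ 3 - 4 * a₂ ^ 3 * ((4 * a₆ + 1) / 4) -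
        27 * ((4 * a₆ + 1) / 4) ^ 2 + 18 * a₂ * a₄ * ((4 * a₆ + 1) / 4)) := by
    field_simp
    ring
  rw [e, hdisc, mul_zero]

/-- In a field of characteristic `≠ 2`: if `Δ(M) = 0` but `a₂² ≠ 3a₄` (`c₄(M) ≠ 0`: a node), the
cubic `h(x) = 4x³ + 4a₂x² + 4a₄x + 4a₆ + 1` has a SIMPLE root in the field — the rational double
root `a` (`TateAlgorithm.exists_double_root_of_cubicDiscr_eq_zero`) gives the simple root
`s = −a₂ − 2a`, with `h'(s)/4 = a₂² − 3a₄`. [folklore] -/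
private theorem exists_simple_root_of_Δ_model_eq_zero {F : Type*} [Field F] (h2 : (2 : F) ≠ 0)
    {a₂ a₄ a₆ : F} (hΔ : (⟨0, a₂, 1, a₄, a₆⟩ : WeierstrassCurve F).Δ = 0)
    (hc₄ : a₂ ^ 2 - 3 * a₄ ≠ 0) :
    ∃ s : F, 4 * s ^ 3 + 4 * a₂ * s ^ 2 + 4 * a₄ * s + (4 * a₆ + 1) = 0 ∧
      12 * s ^ 2 + 8 * a₂ * s + 4 * a₄ ≠ 0 := by
  have h4 : (4 : F) ≠ 0 := by
    rw [show (4 : F) = 2 * 2 by norm_num]; exact mul_ne_zero h2 h2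
  set w : F := (4 * a₆ + 1) / 4 with hw
  have hdisc : a₂ ^ 2 * a₄ ^ 2 - 4 * a₄ ^ 3 - 4 * a₂ ^ 3 * w - 27 * w ^ 2 + 18 * a₂ * a₄ * w = 0 := by
    have e : (16 : F) * (a₂ ^ 2 * a₄ ^ 2 - 4 * a₄ ^ 3 - 4 * a₂ ^ 3 * w - 27 * w ^ 2 +
        18 * a₂ * a₄ * w) = (⟨0, a₂, 1, a₄, a₆⟩ : WeierstrassCurve F).Δ := by
      rw [Δ_model, hw]
      field_simp
      ring
    have h16 : (16 : F) ≠ 0 := by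
      rw [show (16 : F) = 4 * 4 by norm_num]; exact mul_ne_zero h4 h4
    exact (mul_eq_zero.mp (e.trans hΔ)).resolve_left h16
  obtain ⟨a, ha, ha'⟩ :=
    DiophantineGeometry.TateAlgorithm.exists_double_root_of_cubicDiscr_eq_zero h2 a₂ a₄ w hdisc hc₄
  refine ⟨-a₂ - 2 * a, ?_, ?_⟩
  · have hg : (-a₂ - 2 * a) ^ 3 + a₂ * (-a₂ - 2 * a) ^ 2 + a₄ * (-a₂ - 2 * a) + w = 0 := by
      linear_combination ha + (-a₂ - 3 * a) * ha'
    have : 4 * ((-a₂ - 2 * a) ^ 3 + a₂ * (-a₂ - 2 * a) ^ 2 + a₄ * (-a₂ - 2 * a) + w) = 0 := by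
      rw [hg, mul_zero]
    rw [hw] at this
    field_simp at this
    linear_combination this
  · have e : 12 * (-a₂ - 2 * a) ^ 2 + 8 * a₂ * (-a₂ - 2 * a) + 4 * a₄ =
        4 * (a₂ ^ 2 - 3 * a₄) + 16 * (3 * a ^ 2 + 2 * a₂ * a + a₄) := by ring
    rw [e, ha', mul_zero, add_zero]
    exact mul_ne_zero h4 hc₄

/-- The Step-6 cubic `P(T) = T³ + 4d₁ā₂T² + 16d₁²ā₄T + 16d₁³(4ā₆+1)` of the twist model at
`p ∣ d` and the `2`-division cubic `h(x) = 4x³ + 4ā₂x² + 4ā₄x + 4ā₆ + 1` of `M`: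
`P(4d₁x) = 16d₁³·h(x)` and `P'(4d₁x) = 4d₁²·h'(x)` (over any commutative ring). Boxer–Diao
2010, proof of Prop. 4.1: "the number of roots of the polynomial `(d')³f(x/d')` … is just the number
of 2-torsion of `E^{(d')}` mod `p`, which is the same as the number of 2-torsion of `E` mod `p`".
[cite: BoxerDiao2010, proof of Prop. 4.1 (p. 1977)] -/
theorem cubic_rescale {S : Type*} [CommRing S] (e a₂ a₄ a₆ x : S) :
    (4 * e * x) ^ 3 + 4 * e * a₂ * (4 * e * x) ^ 2 + 16 * e ^ 2 * a₄ * (4 * e * x) +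
        16 * e ^ 3 * (4 * a₆ + 1) =
      16 * e ^ 3 * (4 * x ^ 3 + 4 * a₂ * x ^ 2 + 4 * a₄ * x + (4 * a₆ + 1)) ∧
    3 * (4 * e * x) ^ 2 + 2 * (4 * e * a₂) * (4 * e * x) + 16 * e ^ 2 * a₄ =
      4 * e ^ 2 * (12 * x ^ 2 + 8 * a₂ * x + 4 * a₄) := by
  constructor <;> ring


end Invariants


/-! ### Residue field of `ℤ_p` versus `ZMod p` -/

section Residue

variable (p : ℕ) [hp : Fact p.Prime] (M : WeierstrassCurve ℤ)

/-- An integer prime to `p` is non-zero in the residue field of `ℤ_p`. [folklore] -/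
private theorem intCast_residueField_ne_zero {z : ℤ} (h : ¬ (p : ℤ) ∣ z) :
    (z : ResidueField ℤ_[p]) ≠ 0 := by
  rw [← map_intCast (residue ℤ_[p]), residue_ne_zero_iff_isUnit]
  exact isUnit_intCast_padicInt_of_not_dvd h

/-- Transport of the `2`-division cubic `h` of `M` from the residue field of `ℤ_p` to `ZMod p`
along `PadicInt.residueField` (integer coefficients). [folklore] -/
private theorem residueField_cubic (x : ResidueField ℤ_[p]) :
    PadicInt.residueField (4 * x ^ 3 + 4 * (M.a₂ : ResidueField ℤ_[p]) * x ^ 2 +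
        4 * (M.a₄ : ResidueField ℤ_[p]) * x + (4 * (M.a₆ : ResidueField ℤ_[p]) + 1)) =
      4 * (PadicInt.residueField x) ^ 3 + 4 * (M.a₂ : ZMod p) * (PadicInt.residueField x) ^ 2 +
        4 * (M.a₄ : ZMod p) * (PadicInt.residueField x) + (4 * (M.a₆ : ZMod p) + 1) := by
  simp only [map_add, map_mul, map_pow, map_ofNat, map_intCast, map_one]

/-- Transport of `h'` from the residue field of `ℤ_p` to `ZMod p`. [folklore] -/
private theorem residueField_cubic_deriv (x : ResidueField ℤ_[p]) :
    PadicInt.residueField (12 * x ^ 2 + 8 * (M.a₂ : ResidueField ℤ_[p]) * x +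
        4 * (M.a₄ : ResidueField ℤ_[p])) =
      12 * (PadicInt.residueField x) ^ 2 + 8 * (M.a₂ : ZMod p) * (PadicInt.residueField x) +
        4 * (M.a₄ : ZMod p) := by
  simp only [map_add, map_mul, map_pow, map_ofNat, map_intCast]

end Residue

/-! ### The odd places: `c_p` of the integer twist model over `ℤ_p` -/

section OddPrime

variable (p : ℕ) [hp : Fact p.Prime] (M : WeierstrassCurve ℤ) (hM1 : M.a₁ = 0) (hM3 : M.a₃ = 1)
  (d : ℤ)

  (J : WeierstrassCurve ℤ) (hJ : J = ⟨0, 4 * d * M.a₂, 0, 16 * d ^ 2 * M.a₄, 16 * d ^ 3 * (4 * M.a₆ + 1)⟩)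

include hM1 hM3

/-- `M = (0, a₂, 1, a₄, a₆)` as a structure literal. [folklore] -/
private theorem model_eq : M = ⟨0, M.a₂, 1, M.a₄, M.a₆⟩ := by
  ext <;> simp [hM1, hM3]

/-- `Δ(M)` read in any ring `S` is `Δ` of `(0, ā₂, 1, ā₄, ā₆)`. [folklore] -/
private theorem intCast_Δ_eq {S : Type*} [CommRing S] :
    ((M.Δ : ℤ) : S) = (⟨0, (M.a₂ : S), 1, (M.a₄ : S), (M.a₆ : S)⟩ : WeierstrassCurve S).Δ := by
  have e := M.map_Δ (Int.castRingHom S)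
  rw [eq_intCast] at e
  rw [← e]
  congr 1
  ext <;> simp [WeierstrassCurve.map, hM1, hM3]

/-- `c₄(M)` read in any ring `S` is `c₄` of `(0, ā₂, 1, ā₄, ā₆)`. [folklore] -/
private theorem intCast_c₄_eq {S : Type*} [CommRing S] :
    ((M.c₄ : ℤ) : S) = (⟨0, (M.a₂ : S), 1, (M.a₄ : S), (M.a₆ : S)⟩ : WeierstrassCurve S).c₄ := by
  have e := M.map_c₄ (Int.castRingHom S)
  rw [eq_intCast] at e
  rw [← e]
  congr 1
  ext <;> simp [WeierstrassCurve.map, hM1, hM3]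

include hJ

/-- `Δ` of the integer twist model in `ℤ_p`: the integer `2¹² d⁶ Δ(M)`. [cite: SilvermanAEC2009, III.1 Table 3.1] -/
theorem Δ_twistIntModel_padic :
    (J.map (Int.castRingHom ℤ_[p])).Δ = ((2 ^ 12 * d ^ 6 * M.Δ : ℤ) : ℤ_[p]) := by
  rw [WeierstrassCurve.map_Δ, hJ]
  conv_rhs => rw [model_eq M hM1 hM3]
  rw [← Δ_twistIntModel]
  simp

/-- `c₄` of the integer twist model in `ℤ_p`: the integer `16 d² c₄(M)`. [cite: SilvermanAEC2009, III.1 Table 3.1] -/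
theorem c₄_twistIntModel_padic :
    (J.map (Int.castRingHom ℤ_[p])).c₄ = ((16 * d ^ 2 * M.c₄ : ℤ) : ℤ_[p]) := by
  rw [WeierstrassCurve.map_c₄, hJ]
  conv_rhs => rw [model_eq M hM1 hM3]
  rw [← c₄_twistIntModel]
  simp

/-- **`p ∤ 2dΔ(M)` ⇒ `c_p = 1`** (good reduction of the twist at `p`; Boxer–Diao 2010, proof of
Prop. 4.1: "If `p` is an odd prime of good reduction and `(p, d) = 1`, then `E^{(d)}` has good
reduction at `p` and so `c_p = 1`"). [cite: BoxerDiao2010, proof of Prop. 4.1 (p. 1977)] -/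
theorem localTamagawaNumber_twistIntModel_eq_one_of_not_dvd (hp2 : p ≠ 2) (hd : ¬ (p : ℤ) ∣ d)
    (hΔ : ¬ (p : ℤ) ∣ M.Δ) :
    ((J.map (Int.castRingHom ℤ_[p])).baseChange ℚ_[p]).localTamagawaNumber ℤ_[p] = 1 := by
  refine LocalIndex.localTamagawaNumber_baseChange_eq_one_of_isUnit_Δ _ ?_
  rw [Δ_twistIntModel_padic p M hM1 hM3 d J hJ]
  refine isUnit_intCast_padicInt_of_not_dvd fun h => ?_
  have hp' : Prime (p : ℤ) := Nat.prime_iff_prime_int.mp hp.out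
  rcases hp'.dvd_or_dvd h with h | h
  · rcases hp'.dvd_or_dvd h with h | h
    · have h2 : (p : ℤ) ∣ 2 := hp'.dvd_of_dvd_pow h
      have : p ∣ 2 := by exact_mod_cast h2
      exact hp2 ((Nat.prime_dvd_prime_iff_eq hp.out Nat.prime_two).mp this)
    · exact hd (hp'.dvd_of_dvd_pow h)
  · exact hΔ h

/-- **`p ∣ Δ(M)`, `p ∤ 2 d c₄(M)`, `v_p(Δ(M))` odd ⇒ `c_p` odd** (multiplicative reduction of the
twist at `p`, split with `c_p = v_p(Δ)` or non-split with `c_p = 1`; Boxer–Diao 2010, proof of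
Prop. 4.1, p. 1976: "the Tamagawa factor `c_p(E^{(d)})` is odd (it is either `1` or `v_p(Δ_E)` …)").
[cite: BoxerDiao2010, proof of Prop. 4.1 (p. 1976)] -/
theorem odd_localTamagawaNumber_twistIntModel_of_dvd_Δ (hp2 : p ≠ 2) (hd : ¬ (p : ℤ) ∣ d)
    (hc₄ : ¬ (p : ℤ) ∣ M.c₄) (hΔ0 : M.Δ ≠ 0) (hodd : Odd (padicValInt p M.Δ)) :
    Odd (((J.map (Int.castRingHom ℤ_[p])).baseChange ℚ_[p]).localTamagawaNumber ℤ_[p]) := by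
  haveI := henselianLocalRing_padicInt' p
  haveI := finite_residueField_padicInt p
  have hp' : Prime (p : ℤ) := Nat.prime_iff_prime_int.mp hp.out
  have h2 : ¬ (p : ℤ) ∣ 2 := fun h => by
    have : p ∣ 2 := by exact_mod_cast h
    exact hp2 ((Nat.prime_dvd_prime_iff_eq hp.out Nat.prime_two).mp this)
  obtain ⟨m, hm, hpm⟩ := exists_eq_pow_padicValInt_mul_not_dvd (p := p) hΔ0
  generalize hn : padicValInt p M.Δ = n at hm hodd
  have hu : IsUnit (((2 ^ 12 * d ^ 6 * m : ℤ)) : ℤ_[p]) := by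
    refine isUnit_intCast_padicInt_of_not_dvd fun h => ?_
    rcases hp'.dvd_or_dvd h with h | h
    · rcases hp'.dvd_or_dvd h with h | h
      · exact h2 (hp'.dvd_of_dvd_pow h)
      · exact hd (hp'.dvd_of_dvd_pow h)
    · exact hpm h
  refine LocalIndex.odd_localTamagawaNumber_baseChange_of_isUnit_c₄ _ ?_ PadicInt.irreducible_p hu
    ?_ hodd
  · rw [c₄_twistIntModel_padic p M hM1 hM3 d J hJ]
    refine isUnit_intCast_padicInt_of_not_dvd fun h => ?_
    rcases hp'.dvd_or_dvd h with h | h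
    · rcases hp'.dvd_or_dvd h with h | h
      · exact h2 (hp'.dvd_of_dvd_pow (show (p : ℤ) ∣ 2 ^ 4 by simpa using h))
      · exact hd (hp'.dvd_of_dvd_pow h)
    · exact hc₄ h
  · rw [Δ_twistIntModel_padic p M hM1 hM3 d J hJ, hm]
    push_cast
    ring

/-! #### The primes dividing `d`: the Step-6 shape -/

variable {d₁ : ℤ} (hd : d = p * d₁)
include hd

omit hM1 hM3 in
/-- At `p ∣ d`, `d = p d₁`, the integer twist model read in `ℤ_p` has the Step-6 shape
`a₁ = p·0`, `a₂ = p·(4d₁a₂)`, `a₃ = p²·0`, `a₄ = p²·(16d₁²a₄)`, `a₆ = p³·(16d₁³(4a₆+1))`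
(Boxer–Diao 2010, proof of Prop. 4.1: "`E^{(d)} : y² = d³f(x/d)`. Following Tate's algorithm we
end up in step 6"). [cite: BoxerDiao2010, proof of Prop. 4.1 (p. 1977)] -/
theorem twistIntModel_padic_shape :
    (J.map (Int.castRingHom ℤ_[p])).a₁ = (p : ℤ_[p]) * 0 ∧ (J.map (Int.castRingHom ℤ_[p])).a₂ = (p : ℤ_[p]) * (4 * (d₁ : ℤ_[p]) * (M.a₂ : ℤ_[p])) ∧
      (J.map (Int.castRingHom ℤ_[p])).a₃ = (p : ℤ_[p]) ^ 2 * 0 ∧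
      (J.map (Int.castRingHom ℤ_[p])).a₄ = (p : ℤ_[p]) ^ 2 * (16 * (d₁ : ℤ_[p]) ^ 2 * (M.a₄ : ℤ_[p])) ∧
      (J.map (Int.castRingHom ℤ_[p])).a₆ = (p : ℤ_[p]) ^ 3 * (16 * (d₁ : ℤ_[p]) ^ 3 * (4 * (M.a₆ : ℤ_[p]) + 1)) := by
  subst hJ
  simp only [WeierstrassCurve.map_a₁, WeierstrassCurve.map_a₂, WeierstrassCurve.map_a₃,
    WeierstrassCurve.map_a₄, WeierstrassCurve.map_a₆, hd, eq_intCast, Int.cast_zero, Int.cast_mul,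
    Int.cast_pow, Int.cast_add, Int.cast_one, Int.cast_ofNat, Int.cast_natCast]
  refine ⟨by ring, by ring, by ring, by ring, by ring⟩

omit hM1 hM3 hJ hd in
/-- In the residue field `k` of `ℤ_p` (`p ∤ 2d₁`): a root `t` of the Step-6 cubic
`T³ + β̄T² + δ̄T + ε̄` gives the root `x = t/(4d̄₁)` of `h̄`, transported to `ZMod p`. [folklore] -/
private theorem exists_zmod_root_of_cubic_root (hp2 : p ≠ 2) (hd₁ : ¬ (p : ℤ) ∣ d₁)
    {t : ResidueField ℤ_[p]}
    (ht : t ^ 3 + residue ℤ_[p] (4 * (d₁ : ℤ_[p]) * (M.a₂ : ℤ_[p])) * t ^ 2 +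
      residue ℤ_[p] (16 * (d₁ : ℤ_[p]) ^ 2 * (M.a₄ : ℤ_[p])) * t +
      residue ℤ_[p] (16 * (d₁ : ℤ_[p]) ^ 3 * (4 * (M.a₆ : ℤ_[p]) + 1)) = 0) :
    ∃ x : ZMod p, 4 * x ^ 3 + 4 * (M.a₂ : ZMod p) * x ^ 2 + 4 * (M.a₄ : ZMod p) * x +
      (4 * (M.a₆ : ZMod p) + 1) = 0 := by
  have h4d : (4 * (d₁ : ResidueField ℤ_[p])) ≠ 0 := by
    have h4 : ¬ (p : ℤ) ∣ 4 := fun h => by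
      have hp' : Prime (p : ℤ) := Nat.prime_iff_prime_int.mp hp.out
      have : p ∣ 2 := by
        exact_mod_cast hp'.dvd_of_dvd_pow (show (p : ℤ) ∣ 2 ^ 2 by simpa using h)
      exact hp2 ((Nat.prime_dvd_prime_iff_eq hp.out Nat.prime_two).mp this)
    have h4k : ((4 : ℤ) : ResidueField ℤ_[p]) ≠ 0 := intCast_residueField_ne_zero p h4
    have hdk : ((d₁ : ℤ) : ResidueField ℤ_[p]) ≠ 0 := intCast_residueField_ne_zero p hd₁
    push_cast at h4k
    exact mul_ne_zero h4k hdk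
  set x : ResidueField ℤ_[p] := t * (4 * (d₁ : ResidueField ℤ_[p]))⁻¹ with hx
  have htx : t = 4 * (d₁ : ResidueField ℤ_[p]) * x := by
    rw [hx, mul_comm (4 * (d₁ : ResidueField ℤ_[p])), mul_assoc, inv_mul_cancel₀ h4d, mul_one]
  have key := (cubic_rescale (d₁ : ResidueField ℤ_[p]) (M.a₂ : ResidueField ℤ_[p]) (M.a₄ : ResidueField ℤ_[p]) (M.a₆ : ResidueField ℤ_[p]) x).1
  simp only [map_mul, map_pow, map_add, map_ofNat, map_intCast, map_one] at ht
  rw [htx] at ht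
  have h0 : 16 * (d₁ : ResidueField ℤ_[p]) ^ 3 * (4 * x ^ 3 + 4 * (M.a₂ : ResidueField ℤ_[p]) * x ^ 2 + 4 * (M.a₄ : ResidueField ℤ_[p]) * x +
      (4 * (M.a₆ : ResidueField ℤ_[p]) + 1)) = 0 := by
    rw [← key]
    linear_combination ht
  have h16d : (16 * (d₁ : ResidueField ℤ_[p]) ^ 3) ≠ 0 := by
    have : (16 * (d₁ : ResidueField ℤ_[p]) ^ 3) = (4 * (d₁ : ResidueField ℤ_[p])) ^ 2 * (d₁ : ResidueField ℤ_[p]) := by ring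
    rw [this]
    refine mul_ne_zero (pow_ne_zero _ h4d) fun h => h4d ?_
    rw [h, mul_zero]
  have hroot := (mul_eq_zero.mp h0).resolve_left h16d
  refine ⟨PadicInt.residueField x, ?_⟩
  rw [← residueField_cubic p M, hroot, map_zero]

omit hM1 hM3 hJ hd in
/-- Conversely a root `x` of `h̄` in `ZMod p` gives the root `t = 4d̄₁x` of the Step-6 cubic in
the residue field of `ℤ_p`, simple iff `x` is (`P'(4d₁x) = 4d₁² h'(x)`). [folklore] -/
private theorem exists_cubic_root_of_zmod_root (hp2 : p ≠ 2) (hd₁ : ¬ (p : ℤ) ∣ d₁) {x₀ : ZMod p}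
    (hx₀ : 4 * x₀ ^ 3 + 4 * (M.a₂ : ZMod p) * x₀ ^ 2 + 4 * (M.a₄ : ZMod p) * x₀ +
      (4 * (M.a₆ : ZMod p) + 1) = 0)
    (hx₀' : 12 * x₀ ^ 2 + 8 * (M.a₂ : ZMod p) * x₀ + 4 * (M.a₄ : ZMod p) ≠ 0) :
    ∃ t : ResidueField ℤ_[p],
      t ^ 3 + residue ℤ_[p] (4 * (d₁ : ℤ_[p]) * (M.a₂ : ℤ_[p])) * t ^ 2 +
        residue ℤ_[p] (16 * (d₁ : ℤ_[p]) ^ 2 * (M.a₄ : ℤ_[p])) * t +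
        residue ℤ_[p] (16 * (d₁ : ℤ_[p]) ^ 3 * (4 * (M.a₆ : ℤ_[p]) + 1)) = 0 ∧
      3 * t ^ 2 + 2 * residue ℤ_[p] (4 * (d₁ : ℤ_[p]) * (M.a₂ : ℤ_[p])) * t +
        residue ℤ_[p] (16 * (d₁ : ℤ_[p]) ^ 2 * (M.a₄ : ℤ_[p])) ≠ 0 := by
  set x : ResidueField ℤ_[p] := (PadicInt.residueField (p := p)).symm x₀ with hx
  have hφx : PadicInt.residueField x = x₀ := by rw [hx, RingEquiv.apply_symm_apply]
  have hxk : 4 * x ^ 3 + 4 * (M.a₂ : ResidueField ℤ_[p]) * x ^ 2 + 4 * (M.a₄ : ResidueField ℤ_[p]) * x + (4 * (M.a₆ : ResidueField ℤ_[p]) + 1) = 0 := by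
    apply (PadicInt.residueField (p := p)).injective
    rw [residueField_cubic p M, hφx, hx₀, map_zero]
  have hxk' : 12 * x ^ 2 + 8 * (M.a₂ : ResidueField ℤ_[p]) * x + 4 * (M.a₄ : ResidueField ℤ_[p]) ≠ 0 := by
    intro h0
    apply hx₀'
    rw [← hφx, ← residueField_cubic_deriv p M, h0, map_zero]
  have h4d : (4 * (d₁ : ResidueField ℤ_[p])) ≠ 0 := by
    have h4 : ¬ (p : ℤ) ∣ 4 := fun h => by
      have hp' : Prime (p : ℤ) := Nat.prime_iff_prime_int.mp hp.out
      have : p ∣ 2 := by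
        exact_mod_cast hp'.dvd_of_dvd_pow (show (p : ℤ) ∣ 2 ^ 2 by simpa using h)
      exact hp2 ((Nat.prime_dvd_prime_iff_eq hp.out Nat.prime_two).mp this)
    have h4k : ((4 : ℤ) : ResidueField ℤ_[p]) ≠ 0 := intCast_residueField_ne_zero p h4
    have hdk : ((d₁ : ℤ) : ResidueField ℤ_[p]) ≠ 0 := intCast_residueField_ne_zero p hd₁
    push_cast at h4k
    exact mul_ne_zero h4k hdk
  obtain ⟨key, key'⟩ := cubic_rescale (d₁ : ResidueField ℤ_[p]) (M.a₂ : ResidueField ℤ_[p]) (M.a₄ : ResidueField ℤ_[p]) (M.a₆ : ResidueField ℤ_[p]) x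
  refine ⟨4 * (d₁ : ResidueField ℤ_[p]) * x, ?_, ?_⟩
  · simp only [map_mul, map_pow, map_add, map_ofNat, map_intCast, map_one]
    rw [key, hxk, mul_zero]
  · simp only [map_mul, map_pow, map_ofNat, map_intCast]
    rw [key']
    refine mul_ne_zero ?_ hxk'
    have : (4 * (d₁ : ResidueField ℤ_[p]) ^ 2) = (4 * (d₁ : ResidueField ℤ_[p])) * (d₁ : ResidueField ℤ_[p]) := by ring
    rw [this]
    refine mul_ne_zero h4d fun h => h4d ?_
    rw [h, mul_zero]

/-- **`p ∥ d`, `p ∤ 2Δ(M)`, no `2`-torsion root mod `p` ⇒ `c_p = 1`** (type `I₀*` with irreducible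
cubic; Boxer–Diao 2010, proof of Prop. 4.1, p. 1977: "`c_p` is equal to `1` plus the number of
roots …"). [cite: BoxerDiao2010, proof of Prop. 4.1 (p. 1977)] -/
theorem localTamagawaNumber_twistIntModel_eq_one_of_dvd_of_no_root (hp2 : p ≠ 2)
    (hd₁ : ¬ (p : ℤ) ∣ d₁) (hΔ : ¬ (p : ℤ) ∣ M.Δ)
    (hno : ∀ x : ZMod p, 4 * x ^ 3 + 4 * (M.a₂ : ZMod p) * x ^ 2 + 4 * (M.a₄ : ZMod p) * x +
      (4 * (M.a₆ : ZMod p) + 1) ≠ 0) :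
    ((J.map (Int.castRingHom ℤ_[p])).baseChange ℚ_[p]).localTamagawaNumber ℤ_[p] = 1 := by
  have hp' : Prime (p : ℤ) := Nat.prime_iff_prime_int.mp hp.out
  have h2 : ¬ (p : ℤ) ∣ 2 := fun h => by
    have : p ∣ 2 := by exact_mod_cast h
    exact hp2 ((Nat.prime_dvd_prime_iff_eq hp.out Nat.prime_two).mp this)
  obtain ⟨s1, s2, s3, s4, s6⟩ := twistIntModel_padic_shape p M d J hJ hd
  -- minimality: `v(Δ) = 6 < 12`
  have hu : IsUnit (((2 ^ 12 * d₁ ^ 6 * M.Δ : ℤ)) : ℤ_[p]) := by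
    refine isUnit_intCast_padicInt_of_not_dvd fun h => ?_
    rcases hp'.dvd_or_dvd h with h | h
    · rcases hp'.dvd_or_dvd h with h | h
      · exact h2 (hp'.dvd_of_dvd_pow h)
      · exact hd₁ (hp'.dvd_of_dvd_pow h)
    · exact hΔ h
  have hΔeq : (J.map (Int.castRingHom ℤ_[p])).Δ = (p : ℤ_[p]) ^ 6 * (((2 ^ 12 * d₁ ^ 6 * M.Δ : ℤ)) : ℤ_[p]) := by
    rw [Δ_twistIntModel_padic p M hM1 hM3 d J hJ, hd]; push_cast; ring
  haveI : WeierstrassCurve.IsIntegral ℤ_[p] ((J.map (Int.castRingHom ℤ_[p])).baseChange ℚ_[p]) := ⟨⟨_, rfl⟩⟩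
  have hval : (IsDiscreteValuationRing.maximalIdeal ℤ_[p]).valuation ℚ_[p]
      ((J.map (Int.castRingHom ℤ_[p])).baseChange ℚ_[p]).Δ = WithZero.exp (-(6 : ℕ) : ℤ) := by
    rw [WeierstrassCurve.baseChange, WeierstrassCurve.map_Δ, hΔeq]
    exact LocalIndex.valuation_algebraMap_pow_mul_of_isUnit PadicInt.irreducible_p hu 6
  haveI : ((J.map (Int.castRingHom ℤ_[p])).baseChange ℚ_[p]).IsMinimal ℤ_[p] :=
    WeierstrassCurve.isMinimal_of_exp_lt_valuation_Δ _
      (by rw [hval, WithZero.exp_lt_exp]; norm_num)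
  have hΔK : ((J.map (Int.castRingHom ℤ_[p])).baseChange ℚ_[p]).Δ ≠ 0 := by
    rw [WeierstrassCurve.baseChange, WeierstrassCurve.map_Δ, hΔeq]
    exact (map_ne_zero_iff _ (IsFractionRing.injective ℤ_[p] ℚ_[p])).mpr
      (mul_ne_zero (pow_ne_zero _ PadicInt.irreducible_p.ne_zero) hu.ne_zero)
  haveI : ((J.map (Int.castRingHom ℤ_[p])).baseChange ℚ_[p]).IsElliptic :=
    (WeierstrassCurve.isElliptic_iff _).mpr (Ne.isUnit hΔK)
  refine LocalIndex.localTamagawaNumber_baseChange_eq_one_of_cubic_no_root _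
    PadicInt.irreducible_p s1 s2 s3 s4 s6 fun t ht => ?_
  obtain ⟨x, hx⟩ := exists_zmod_root_of_cubic_root p M hp2 hd₁ ht
  exact hno x hx

/-- **`p ∥ d`, `p ∤ 2Δ(M)`, a `2`-torsion root mod `p` ⇒ `2 ∣ c_p`** (type `I₀*` with a rational
root of the cubic — it is simple because `p ∤ Δ(M)`; Boxer–Diao 2010, proof of Prop. 4.1, p. 1977).
[cite: BoxerDiao2010, proof of Prop. 4.1 (p. 1977)] -/
theorem two_dvd_localTamagawaNumber_twistIntModel_of_dvd_of_root (hp2 : p ≠ 2)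
    (hd₁ : ¬ (p : ℤ) ∣ d₁) (hΔ : ¬ (p : ℤ) ∣ M.Δ)
    (hx : ∃ x : ZMod p, 4 * x ^ 3 + 4 * (M.a₂ : ZMod p) * x ^ 2 + 4 * (M.a₄ : ZMod p) * x +
      (4 * (M.a₆ : ZMod p) + 1) = 0) :
    2 ∣ ((J.map (Int.castRingHom ℤ_[p])).baseChange ℚ_[p]).localTamagawaNumber ℤ_[p] := by
  haveI := henselianLocalRing_padicInt' p
  have hp' : Prime (p : ℤ) := Nat.prime_iff_prime_int.mp hp.out
  have h2 : ¬ (p : ℤ) ∣ 2 := fun h => by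
    have : p ∣ 2 := by exact_mod_cast h
    exact hp2 ((Nat.prime_dvd_prime_iff_eq hp.out Nat.prime_two).mp this)
  have h2z : (2 : ZMod p) ≠ 0 := by
    intro h
    apply h2
    have : ((2 : ℤ) : ZMod p) = 0 := by exact_mod_cast h
    exact (ZMod.intCast_zmod_eq_zero_iff_dvd 2 p).mp this
  obtain ⟨s1, s2, s3, s4, s6⟩ := twistIntModel_padic_shape p M d J hJ hd
  have hu : IsUnit (((2 ^ 12 * d₁ ^ 6 * M.Δ : ℤ)) : ℤ_[p]) := by
    refine isUnit_intCast_padicInt_of_not_dvd fun h => ?_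
    rcases hp'.dvd_or_dvd h with h | h
    · rcases hp'.dvd_or_dvd h with h | h
      · exact h2 (hp'.dvd_of_dvd_pow h)
      · exact hd₁ (hp'.dvd_of_dvd_pow h)
    · exact hΔ h
  have hΔeq : (J.map (Int.castRingHom ℤ_[p])).Δ = (p : ℤ_[p]) ^ 6 * (((2 ^ 12 * d₁ ^ 6 * M.Δ : ℤ)) : ℤ_[p]) := by
    rw [Δ_twistIntModel_padic p M hM1 hM3 d J hJ, hd]; push_cast; ring
  haveI : WeierstrassCurve.IsIntegral ℤ_[p] ((J.map (Int.castRingHom ℤ_[p])).baseChange ℚ_[p]) := ⟨⟨_, rfl⟩⟩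
  have hval : (IsDiscreteValuationRing.maximalIdeal ℤ_[p]).valuation ℚ_[p]
      ((J.map (Int.castRingHom ℤ_[p])).baseChange ℚ_[p]).Δ = WithZero.exp (-(6 : ℕ) : ℤ) := by
    rw [WeierstrassCurve.baseChange, WeierstrassCurve.map_Δ, hΔeq]
    exact LocalIndex.valuation_algebraMap_pow_mul_of_isUnit PadicInt.irreducible_p hu 6
  haveI : ((J.map (Int.castRingHom ℤ_[p])).baseChange ℚ_[p]).IsMinimal ℤ_[p] :=
    WeierstrassCurve.isMinimal_of_exp_lt_valuation_Δ _
      (by rw [hval, WithZero.exp_lt_exp]; norm_num)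
  have hΔK : ((J.map (Int.castRingHom ℤ_[p])).baseChange ℚ_[p]).Δ ≠ 0 := by
    rw [WeierstrassCurve.baseChange, WeierstrassCurve.map_Δ, hΔeq]
    exact (map_ne_zero_iff _ (IsFractionRing.injective ℤ_[p] ℚ_[p])).mpr
      (mul_ne_zero (pow_ne_zero _ PadicInt.irreducible_p.ne_zero) hu.ne_zero)
  haveI : ((J.map (Int.castRingHom ℤ_[p])).baseChange ℚ_[p]).IsElliptic :=
    (WeierstrassCurve.isElliptic_iff _).mpr (Ne.isUnit hΔK)
  obtain ⟨x₀, hx₀⟩ := hx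
  -- the root is simple since `p ∤ Δ(M)`
  have hx₀' : 12 * x₀ ^ 2 + 8 * (M.a₂ : ZMod p) * x₀ + 4 * (M.a₄ : ZMod p) ≠ 0 := by
    intro h0
    apply hΔ
    apply (ZMod.intCast_zmod_eq_zero_iff_dvd _ p).mp
    rw [intCast_Δ_eq M hM1 hM3]
    exact Δ_model_eq_zero_of_double_root h2z hx₀ h0
  obtain ⟨t, ht, ht'⟩ := exists_cubic_root_of_zmod_root p M hp2 hd₁ hx₀ hx₀'
  exact LocalIndex.two_dvd_localTamagawaNumber_baseChange_of_cubic_simple_root _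
    PadicInt.irreducible_p s1 s2 s3 s4 s6 ht ht'

/-- **`p ∥ d`, `p ∣ Δ(M)`, `p ∤ 2c₄(M)` ⇒ `2 ∣ c_p`** (type `Iₙ*`: the cubic mod `p` has a double
root and a SIMPLE root, `exists_simple_root_of_Δ_model_eq_zero`; Boxer–Diao 2010, proof of Prop.
4.1 (2), p. 1977: "`E^{(d)}` has Kodaira symbol `Iₙ*` at `p`, and … `c_p = 2` or `4`. Thus the
Tamagawa product for `E^{(d)}` is even"). [cite: BoxerDiao2010, proof of Prop. 4.1 (2) (p. 1977)] -/
theorem two_dvd_localTamagawaNumber_twistIntModel_of_dvd_of_dvd_Δ (hp2 : p ≠ 2)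
    (hd₁ : ¬ (p : ℤ) ∣ d₁) (hΔ : (p : ℤ) ∣ M.Δ) (hc₄ : ¬ (p : ℤ) ∣ M.c₄) (hΔ0 : M.Δ ≠ 0) :
    2 ∣ ((J.map (Int.castRingHom ℤ_[p])).baseChange ℚ_[p]).localTamagawaNumber ℤ_[p] := by
  haveI := henselianLocalRing_padicInt' p
  have hp' : Prime (p : ℤ) := Nat.prime_iff_prime_int.mp hp.out
  have h2 : ¬ (p : ℤ) ∣ 2 := fun h => by
    have : p ∣ 2 := by exact_mod_cast h
    exact hp2 ((Nat.prime_dvd_prime_iff_eq hp.out Nat.prime_two).mp this)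
  have h2z : (2 : ZMod p) ≠ 0 := by
    intro h
    apply h2
    have : ((2 : ℤ) : ZMod p) = 0 := by exact_mod_cast h
    exact (ZMod.intCast_zmod_eq_zero_iff_dvd 2 p).mp this
  obtain ⟨s1, s2, s3, s4, s6⟩ := twistIntModel_padic_shape p M d J hJ hd
  -- minimality: `v(c₄) = 2 < 4`
  have hu : IsUnit (((16 * d₁ ^ 2 * M.c₄ : ℤ)) : ℤ_[p]) := by
    refine isUnit_intCast_padicInt_of_not_dvd fun h => ?_
    rcases hp'.dvd_or_dvd h with h | h
    · rcases hp'.dvd_or_dvd h with h | h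
      · exact h2 (hp'.dvd_of_dvd_pow (show (p : ℤ) ∣ 2 ^ 4 by simpa using h))
      · exact hd₁ (hp'.dvd_of_dvd_pow h)
    · exact hc₄ h
  have hc₄eq : (J.map (Int.castRingHom ℤ_[p])).c₄ = (p : ℤ_[p]) ^ 2 * (((16 * d₁ ^ 2 * M.c₄ : ℤ)) : ℤ_[p]) := by
    rw [c₄_twistIntModel_padic p M hM1 hM3 d J hJ, hd]; push_cast; ring
  haveI : WeierstrassCurve.IsIntegral ℤ_[p] ((J.map (Int.castRingHom ℤ_[p])).baseChange ℚ_[p]) := ⟨⟨_, rfl⟩⟩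
  have hval : (IsDiscreteValuationRing.maximalIdeal ℤ_[p]).valuation ℚ_[p]
      ((J.map (Int.castRingHom ℤ_[p])).baseChange ℚ_[p]).c₄ = WithZero.exp (-(2 : ℕ) : ℤ) := by
    rw [WeierstrassCurve.baseChange, WeierstrassCurve.map_c₄, hc₄eq]
    exact LocalIndex.valuation_algebraMap_pow_mul_of_isUnit PadicInt.irreducible_p hu 2
  haveI : ((J.map (Int.castRingHom ℤ_[p])).baseChange ℚ_[p]).IsMinimal ℤ_[p] :=
    WeierstrassCurve.isMinimal_of_exp_lt_valuation_c₄ _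
      (by rw [hval, WithZero.exp_lt_exp]; norm_num)
  have hΔM0 : (J.map (Int.castRingHom ℤ_[p])).Δ ≠ 0 := by
    rw [Δ_twistIntModel_padic p M hM1 hM3 d J hJ]
    have : (2 ^ 12 * d ^ 6 * M.Δ : ℤ) ≠ 0 := by
      refine mul_ne_zero (mul_ne_zero (by norm_num) (pow_ne_zero _ ?_)) hΔ0
      rw [hd]; exact mul_ne_zero (by exact_mod_cast hp.out.ne_zero) fun h => hd₁ (h ▸ dvd_zero _)
    exact_mod_cast this
  have hΔK : ((J.map (Int.castRingHom ℤ_[p])).baseChange ℚ_[p]).Δ ≠ 0 := by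
    rw [WeierstrassCurve.baseChange, WeierstrassCurve.map_Δ]
    exact (map_ne_zero_iff _ (IsFractionRing.injective ℤ_[p] ℚ_[p])).mpr hΔM0
  haveI : ((J.map (Int.castRingHom ℤ_[p])).baseChange ℚ_[p]).IsElliptic :=
    (WeierstrassCurve.isElliptic_iff _).mpr (Ne.isUnit hΔK)
  -- the simple root of `h̄`
  have hΔz : (⟨0, (M.a₂ : ZMod p), 1, (M.a₄ : ZMod p), (M.a₆ : ZMod p)⟩ :
      WeierstrassCurve (ZMod p)).Δ = 0 := by
    rw [← intCast_Δ_eq M hM1 hM3]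
    exact (ZMod.intCast_zmod_eq_zero_iff_dvd _ p).mpr hΔ
  have hc₄z : (M.a₂ : ZMod p) ^ 2 - 3 * (M.a₄ : ZMod p) ≠ 0 := by
    intro h0
    apply hc₄
    apply (ZMod.intCast_zmod_eq_zero_iff_dvd _ p).mp
    rw [intCast_c₄_eq M hM1 hM3, c₄_model, h0, mul_zero]
  obtain ⟨x₀, hx₀, hx₀'⟩ := exists_simple_root_of_Δ_model_eq_zero h2z hΔz hc₄z
  obtain ⟨t, ht, ht'⟩ := exists_cubic_root_of_zmod_root p M hp2 hd₁ hx₀ hx₀'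
  exact LocalIndex.two_dvd_localTamagawaNumber_baseChange_of_cubic_simple_root _
    PadicInt.irreducible_p s1 s2 s3 s4 s6 ht ht'

end OddPrime

end BoxerDiao2010

end Literature.NumberTheory.EllipticCurves

end
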